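import Summits.BirchSwinnertonDyer.BirchSwinnertonDyer.Theorems.Rank1ResidualJetCoreVertexWalkRowTwoLevel
import Summits.BirchSwinnertonDyer.BirchSwinnertonDyer.Theorems.Rank1ResidualJetTildeClassLevelLink
import Summits.BirchSwinnertonDyer.Rank1Residual.JET.McCallumProp44ByName
import Summits.BirchSwinnertonDyer.BirchSwinnertonDyer.Theorems.ClassRecordThreeEulerHalvesAtThreeWalkCompatData
import Summits.BirchSwinnertonDyer.BirchSwinnertonDyer.Theorems.ClassRecordThreeEulerHalvesAtThreeWalkTildeSign
import Summits.BirchSwinnertonDyer.BirchSwinnertonDyer.Theorems.ClassRecordThreeEulerHalvesAtThreeWalkOrders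
import Summits.BirchSwinnertonDyer.BirchSwinnertonDyer.Theorems.ClassRecordThreeEulerHalvesAtThreeWalkSupplyTrivia
import Summits.BirchSwinnertonDyer.BirchSwinnertonDyer.Theorems.ClassRecordThreeEulerHalvesAtThreeWalkSupplyDuality
import Summits.BirchSwinnertonDyer.BirchSwinnertonDyer.Theorems.ClassRecordThreeEulerHalvesAtThreeWalkSupplyPT
import Summits.BirchSwinnertonDyer.BirchSwinnertonDyer.Theorems.ClassRecordThreeEulerHalvesAtThreeWalkSupplyDisjoint
import Summits.BirchSwinnertonDyer.BirchSwinnertonDyer.Theorems.ClassRecordThreeEulerHalvesAtThreeWalkSupplyRootTransverse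
import Summits.BirchSwinnertonDyer.BirchSwinnertonDyer.Theorems.ClassRecordThreeEulerHalvesAtThreeWalkSupplyTransverse
import Summits.BirchSwinnertonDyer.BirchSwinnertonDyer.Theorems.ClassRecordThreeEulerHalvesAtThreeKolyvaginRedefinition
import Summits.BirchSwinnertonDyer.BirchSwinnertonDyer.Theorems.ClassRecordThreeEulerHalvesAtThreeJetchevTight
import Summits.BirchSwinnertonDyer.BirchSwinnertonDyer.Theorems.ClassRecordThreeEulerHalvesAtThreeSection6Bridge
import Summits.BirchSwinnertonDyer.BirchSwinnertonDyer.Theorems.KolyvaginRoadThreePointCertificate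
import Summits.BirchSwinnertonDyer.BirchSwinnertonDyer.Theorems.Rank1ResidualJetThm63KernelInputsV3
import Summits.BirchSwinnertonDyer.BirchSwinnertonDyer.Theorems.Rank1ResidualJetTransverseClass
import Summits.BirchSwinnertonDyer.BirchSwinnertonDyer.Theorems.Rank1ResidualJetKolyvaginLocalTerm
import Summits.BirchSwinnertonDyer.BirchSwinnertonDyer.Theorems.Rank1ResidualJetWeilDatum
import Summits.BirchSwinnertonDyer.BirchSwinnertonDyer.Theorems.Rank1ResidualJetSelmerLemmas
import Summits.BirchSwinnertonDyer.BirchSwinnertonDyer.Theorems.Rank1ResidualJetCoreVertexBridge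
import Summits.BirchSwinnertonDyer.Rank1Residual.JET.GrossProp53Kolyvagin
import Summits.BirchSwinnertonDyer.Rank1Residual.JET.RingClassTransverseLagrangian
import Summits.BirchSwinnertonDyer.Rank1Residual.JET.TransverseFamilyConjAct
import HarnessLib

/-!
# T1 JET (cell `bsd-jet`), road K — STRIKE K5 VERBATIM: `JET.JetchevCoreVertexExistence` (Jetchev
# 2008 Prop. 5.3 «core vertices exist» READ at `p ∣ N`) is a KERNEL THEOREM modulo NAMED PRINT ONLY

HONEST FRAMING (programme file §HONESTY, verbatim): «no tranche here proves BSD; ARM L moves the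
LITERAL column of an r ≤ 1 census into the kernel-proved-modulo-named-print column.» THEOREMS ONLY
(seat `bsd-jet-pv-1`, session g8; `--supports stmt-BirchSwinnertonDyer-14418`, helper); nothing is
booked, no flag is struck by this file, 0 classes move; K1 ∕ K3 ∕ K4 stay `@[conjecture]`; K5 stays a
`def` (its consumers take `(hCV : JetchevCoreVertexExistence)` and can now be fed by name).

WHAT THIS FILE DOES. `jetchevCoreVertexExistence_lt_of_namedPrint` (p543972) proved the body of K5
under the extra premise `s < m` — an artefact of ONE-level bookkeeping (depths read off the level-`k`
classes `κ_{n,k}`, which die when `m(n) ≥ k`). Jetchev's printed proof (pp. 823–824) reads depths off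
the classes at the HIGHER level `k + s` ([J] Lemma 3.4 with `M(n) ≥ k + m(n)`); so does this file: the
TWO-LEVEL walk `JET.exists_coreVertex_of_orderedFamilies_two` (Selmer modules at `p^k`, depth classes
`c_{k+s}(P_n)` at `p^{k+s}`) is fed with the SAME row suppliers as the predecessor (cell `bsd-stepL`'s
dictionary at general `p`: based data family with Prop. 4.7 along increasing prime chains from [McC]
Prop. 4.4, now at level `k + s`; Gross Prop. 5.3 BY NAME and the sign function; `hdisj` [J] §4.2; `hPT`
Lemma 5.2 (iii) from Poitou–Tate + Weil datum + Gross's dihedral set-up; `hκt` §3.1 item 7 with PURE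
Selmer membership from Gross 6.2 (1) mod [GZ86 III (3.1)] at Kolyvagin conductors and Howard's
transverseness, sign by Gross Prop. 5.4; `hordκ` `Koly.hordκ_of_admissibleData` at level `k + s`) plus
ONE new clause, the LEVEL LINK `ι_* κ̃_n = p^{s−m(n)} · c_{k+s}(P_n)` in `H¹(K, E[p^{k+s}])` read at a
Kolyvagin place `λ` of index `≥ k + s` (`JET.addOrderOf_localization_kolyvaginClass_of_rootClass`,
`Rank1ResidualJetTildeClassLevelLink.lean`; `E(K_λ)[p^{k+s}] = E[p^{k+s}]` by
`Walk.resGal_adicCompletion_smul_torsion_eq_self`): `ord loc_λ κ̃_n = p^k ⟹ ord loc_λ c_{k+s}(P_n) = p^{k+s−m(n)}`.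
RESULTS: `jetchevCoreVertexExistence_of_namedPrint : h44 → hPT → hGZ → JET.JetchevCoreVertexExistence`
and `jetchevCoreVertexExistence_of_literature : hPT → hF1 → h372 → JET.JetchevCoreVertexExistence`
(`h44 := JET.prop44_of_frobeniusCongruence h372`, (γ) image-free; `hGZ := JET.forall_hGZ_of_Gross1991 hF1`):
the reading binder K5 of the road-K END FORMS is DISCHARGED verbatim; road K's residual by name is
unchanged, {[McC] Prop. 5.2, Poitou–Tate, F1, (γ)}. References (locators only; no cited FACT is
declared): [cite: Jetchev2008, Prop. 5.3 (p. 823), proof pp. 823–824 = arXiv Prop. 6.4; §3.1 item 7,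
Lemma 3.4, §4.2, Prop. 4.4, Lemma 5.1] [cite: McCallumLMS1991, §3 (3), Cor. 3.2, §4 (4)–(6), Prop. 4.4,
Lemma 4.6] [cite: GrossLMS1991, §3 (3.1), Prop. 3.7 (2), Prop. 5.3, Prop. 5.4, Prop. 6.2 (1), Prop. 9.6]
[cite: GrossZagier1986, III (3.1)] [cite: Howard2004HeegnerKolyvagin, Lemma 2.7.3]
[cite: MilneADT2006, Ch. I, Thm. 4.10(b)] [cite: WZhang2014, Notations (xii)].
Design: two theorems, no definitions; `K : Type`. Axioms: `propext`, `Classical.choice`, `Quot.sound`.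
-/

set_option autoImplicit false

noncomputable section

open scoped Classical NumberField Pointwise

namespace Summit.BirchSwinnertonDyer.Rank1Residual.JET

open WeierstrassCurve IsDedekindDomain NumberField Field Literature.NumberTheory.EllipticCurves
  Literature.NumberTheory.EllipticCurves.ModularForms Literature.NumberTheory.EllipticCurves.Jetchev2008
  Literature.NumberTheory.EllipticCurves.KolyvaginCocycle
  Literature.NumberTheory.GaloisRepresentations Literature.NumberTheory.GaloisCohomology
  Literature.NumberTheory.GaloisRepresentations.DiscreteGaloisModule
  Summit.BirchSwinnertonDyer.Rank1Residual.X11b Summit.BirchSwinnertonDyer.Rank1Residual.X11b.Three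
  Summit.BirchSwinnertonDyer.Rank1Residual.X11b.Three.Koly
  Summit.BirchSwinnertonDyer.Rank1Residual.JET.SelmerVocabulary Literature.NumberTheory.Automorphic

set_option maxHeartbeats 800000 in
/-- **K5 VERBATIM from NAMED PRINT ONLY** — `JET.JetchevCoreVertexExistence` (Jetchev 2008 Prop. 5.3
read at `p ∣ N`: for `c ∈ Λ` with a datum of exact depth `s`, `s + m ≤ M(c)`, a core vertex
`c' ∈ Λ_{m+s}` for `m` with a datum whose derived point is of infinite order and not `p^{s+1}`-divisible)
follows from [McC] Prop. 4.4 (`h44`), Poitou–Tate duality for Selmer structures (`hPT`) and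
[GZ86 III (3.1)] in the receptacle form at square-free Kolyvagin conductors (`hGZ`). PROOF: the TWO-LEVEL
kernel walk (Selmer modules at `p^m`, depths at `p^{m+s}`), see the module docstring.
[cite: Jetchev2008, Prop. 5.3 (p. 823), proof pp. 823–824, Lemma 3.4] [cite: McCallumLMS1991, §3 (3), Cor. 3.2, §4 Prop. 4.4]
[cite: GrossLMS1991, Prop. 5.4, Prop. 6.2 (1), Prop. 9.6] [cite: GrossZagier1986, III (3.1)] -/
theorem jetchevCoreVertexExistence_of_namedPrint
    (h44 : McCallum1991.prop44_localOrder_kolyvaginClass_mul_eq)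
    (hPT : ∀ (K : Type) [Field K] [NumberField K], poitouTate_selmerStructure_duality_conj K)
    (hGZ : ∀ (W : WeierstrassCurve ℚ) [W.IsElliptic] [W.IsGloballyMinimal] [NeZero (W.conductorNorm ℤ)]
      (K : Type) [Field K] [NumberField K], IsImaginaryQuadratic K →
      NumberField.discr K ≠ -3 → NumberField.discr K ≠ -4 →
      SatisfiesHeegnerHypothesis (W.conductorNorm ℤ) K →
      ∀ (p : ℕ) [Fact p.Prime], p ≠ 2 → W.HasSurjectiveModNGaloisRep p →
      ∀ (Dt : ModularParametrizationData W (W.conductorNorm ℤ)) (β : ℤ) (ι : K →+* ℂ)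
      [∀ j : ℕ, NumberField (ringClassField K ι j)],
      ∃ n' : ℤ, IsCoprime (p : ℤ) n' ∧ ∀ (m : ℕ), Squarefree m →
        (∀ q ∈ m.primeFactors, Zhang2014.IsKolyvaginPrime (W.conductorNorm ℤ) W K p q) →
        ∀ (dm : KolyvaginHeegnerData Dt β ι m)
        (γ : ringClassField K ι m ≃ₐ[ℚ] ringClassField K ι m), γ ∈ ringClassGal ι m →
        ∀ v : HeightOneSpectrum (𝓞 K), ¬ (W.baseChange K).HasGoodReductionAt v →
          n' • pointsMap (W.baseChange K) (v.adicCompletion K)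
              (dm.toGeomPoints (pointGalHom W (ringClassField K ι m) γ dm.y)) ∈
            E0Receptacle (W.baseChange K) v ∧
          ∀ (ℓ : ℕ), ℓ ∈ m.primeFactors → ∀ (dm' : KolyvaginHeegnerData Dt β ι (m / ℓ))
            (hle : ringClassField K ι (m / ℓ) ≤ ringClassField K ι m),
            n' • pointsMap (W.baseChange K) (v.adicCompletion K)
                (dm.toGeomPoints (pointGalHom W (ringClassField K ι m) γ
                  (WeierstrassCurve.Affine.Point.map (W' := W)
                    ((RingClassField.inclusion ι hle).restrictScalars ℚ) dm'.y))) ∈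
              E0Receptacle (W.baseChange K) v) :
    JetchevCoreVertexExistence := by
  intro W _ _ _ hcm K _ _ hK hD3 hD4 hH τ hτ p _ hp2 htower Dt β ι _ _d₁ _hy k hk c d hcsq hcKol s _hnt hdvd
    hndvd hsM
  have hp : p.Prime := Fact.out
  have hρ : W.HasSurjectiveModNGaloisRep p := by simpa using htower 1
  have hD : NumberField.discr K < -4 := KolyvaginAssembly.discr_lt_neg_four hK ⟨hD3, hD4⟩
  have hND : IsCoprime ((W.conductorNorm ℤ : ℕ) : ℤ) (NumberField.discr K) :=
    KolyvaginAssembly.isCoprime_discr_of_satisfiesHeegnerHypothesis hK hH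
  have hτ2 : τ * τ = 1 := Walk.algEquiv_mul_self_eq_one hK τ hτ
  haveI : NeZero (p ^ k) := ⟨pow_ne_zero k hp.ne_zero⟩
  haveI : Finite (geomTorsion (W.baseChange K) ((p ^ k : ℕ) : ℤ)) :=
    finite_geomTorsion_of_neZero (W.baseChange K) (p ^ k)
  -- `c` is admissible at level `k + s`: every prime factor has index `≥ s + k`
  have hsM' : ((k + s : ℕ) : ℕ∞) ≤ Zhang2014.levelIndex W p c := by rw [Nat.add_comm]; exact hsM
  have hcidx : ∀ q ∈ c.primeFactors, k + s ≤ Zhang2014.kolyvaginIndex W p q :=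
    Zhang2014.natCast_le_levelIndex_iff.mp hsM'
  have hks : 1 ≤ k + s := le_trans hk (Nat.le_add_right k s)
  have hc : Squarefree c ∧ ∀ q ∈ c.primeFactors,
      Zhang2014.IsKolyvaginPrime (W.conductorNorm ℤ) W K p q ∧ k + s ≤ Zhang2014.kolyvaginIndex W p q :=
    ⟨hcsq, fun q hq ↦ ⟨hcKol q hq, hcidx q hq⟩⟩
  -- [GZ86 III (3.1)] at this frame (scoped schema), Gross Prop. 5.3 BY NAME, the sign function
  obtain ⟨n', hcop', hGZ'⟩ := hGZ W K hK hD3 hD4 hH p hp2 hρ Dt β ι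
  obtain ⟨ε, hε, h53⟩ := grossProp53_schema_kolyvagin W hK hH p Dt β ι
  obtain ⟨eb, heb, hebε⟩ := Walk.exists_signFunction ε hε
  -- the based data family with Prop. 4.7 AT LEVEL `k + s` along increasing prime chains ([McC] 4.4)
  obtain ⟨D, hDd, h47⟩ := exists_data_h47Base_of_prop44 h44 W hcm hK hD hH hp2 htower Dt β ι hks hc d
  -- the global intrinsic transverse family at level `p^k`
  obtain ⟨𝒯, h𝒯, -⟩ := Walk.exists_globalTransverseFamily W ι ((p ^ k : ℕ) : ℤ)
  -- admissible numbers are divisor-closed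
  have hadm : ∀ (s₀ : {m : ℕ // Squarefree m ∧ ∀ q ∈ m.primeFactors,
      Zhang2014.IsKolyvaginPrime (W.conductorNorm ℤ) W K p q ∧ k + s ≤ Zhang2014.kolyvaginIndex W p q})
      (m' : ℕ), m' ∣ s₀.1 → Squarefree m' ∧ ∀ q ∈ m'.primeFactors,
      Zhang2014.IsKolyvaginPrime (W.conductorNorm ℤ) W K p q ∧ k + s ≤ Zhang2014.kolyvaginIndex W p q :=
    fun s₀ m' hm' ↦ ⟨s₀.2.1.squarefree_of_dvd hm',
      fun q hq ↦ s₀.2.2 q (Nat.primeFactors_mono hm' s₀.2.1.ne_zero hq)⟩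
  -- depth bookkeeping at `c`: `m(c) = s`, `k + s ≤ M(c)`
  have hdiv : divOrd (D ⟨c, hc⟩) p = (s : ℕ∞) := by
    rw [hDd]; exact divOrd_eq_natCast_of_exact d p hdvd hndvd
  have hsMc : (s : ℕ∞) < Zhang2014.levelIndex W p c := by
    refine lt_of_lt_of_le ?_ hsM'
    exact_mod_cast Nat.lt_add_of_pos_left (Nat.lt_of_lt_of_le Nat.zero_lt_one hk)
  have hmc : (if divOrd (D ⟨c, hc⟩) p < Zhang2014.levelIndex W p c then divOrd (D ⟨c, hc⟩) p
      else (⊤ : ℕ∞)) = (s : ℕ∞) := by rw [hdiv, if_pos hsMc]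
  -- τ-stability of the global family at the places of every admissible conductor (Gross §3 dihedral)
  have h𝒯σ' : ∀ (s₀ : {m : ℕ // Squarefree m ∧ ∀ q ∈ m.primeFactors,
        Zhang2014.IsKolyvaginPrime (W.conductorNorm ℤ) W K p q ∧ k + s ≤ Zhang2014.kolyvaginIndex W p q})
      (v w : HeightOneSpectrum (𝓞 K)) (h : τ • v = w), v ∈ placesDividing K s₀.1 →
      ∀ x : galoisCohomology (((W.baseChange K).torsionGaloisModule ((p ^ k : ℕ) : ℤ)).toLocal
        (Sum.inr v : Place K)) 1,
      x ∈ 𝒯 (Sum.inr v) → conjActPlace W τ ((p ^ k : ℕ) : ℤ) h x ∈ 𝒯 (Sum.inr w) :=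
    fun s₀ v w h hv x hx ↦ Walk.globalTransverse_conjActPlace_mem h𝒯 τ s₀.2.1
      (forall_conjActPlace_mem_of_eq_iInf_transverseSubgroup W hK ι τ ((p ^ k : ℕ) : ℤ) s₀.1) v w h hv x hx
  -- ### the FULL TWO-LEVEL kernel walk on the row objects
  have key := exists_coreVertex_of_orderedFamilies_two W K hK p hp2 hρ
    Dt β ι τ hτ k s hk 𝒯 D eb heb c hc hmc ?hdisj ?hPT ?hκt
    (hordκ_of_admissibleData W hK hND hD hp2 hρ Dt β ι (k + s) D) h47
  · -- ### read the conclusion in K5's currency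
    obtain ⟨s', _, hB, hcyc, hcard, hms'⟩ := key
    have hs0' : s'.1 ≠ 0 := s'.2.1.ne_zero
    -- `m(s') ≤ s`: finite depth `≤ s` below `M(s')`
    have hlt' : divOrd (D s') p < Zhang2014.levelIndex W p s'.1 := by
      by_contra h
      rw [if_neg h, top_le_iff] at hms'
      exact ENat.coe_ne_top s hms'
    have hdle : divOrd (D s') p ≤ (s : ℕ∞) := by rwa [if_pos hlt'] at hms'
    have hnd' : ¬ PDiv (D s') p (s + 1) := fun h ↦ by
      have h1 : ((s + 1 : ℕ) : ℕ∞) ≤ (s : ℕ∞) := (le_divOrd_of_pDiv (p := p) (D s') h).trans hdle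
      exact absurd (by exact_mod_cast h1 : s + 1 ≤ s) (by omega)
    -- `P_{s'}` of infinite order: `E(K[s'])` has no `p`-torsion
    have hA : ∀ R : (W.baseChange (ringClassField K ι s'.1)).toAffine.Point, (p : ℤ) • R = 0 → R = 0 :=
      fun R hR ↦ X11b.RingClassNoTorsion.eq_zero_of_zsmul_pow_eq_zero_ringClassField W hK ι hs0' hp hp2
        hρ 1 R (by simpa using hR)
    have hnt' : ¬ IsOfFinAddOrder (D s').derivedPoint :=
      fun hfin ↦ hnd' (exists_pow_smul_eq_of_isOfFinAddOrder hp hA hfin (s + 1))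
    -- `H_{𝓕(s')}` in the `modifiedSelmerGroup` currency
    have hFeq : (selmerF W ((p ^ k : ℕ) : ℤ) 𝒯 (placesDividing K s'.1)).selmerGroup =
        modifiedSelmerGroup W K ι ((p ^ k : ℕ) : ℤ) s'.1 :=
      SelmerVocabulary.selmerGroup_selmerF_eq_modifiedSelmerGroup W ι ((p ^ k : ℕ) : ℤ) 𝒯 hs0'
        (fun x ↦ Walk.globalTransverse_mem_iff h𝒯 s'.2.1 x)
    rw [hFeq] at hB hcyc hcard
    -- the core-vertex package, with the two signs generalised (no dependent rewriting)
    have hpack : ∀ e₁ e₂ : ℤ, e₁ = (if eb s'.1 then (1 : ℤ) else -1) → e₂ = (if !eb s'.1 then (1 : ℤ) else -1) →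
        IsAddCyclic (signPart W K τ ((p ^ k : ℕ) : ℤ) e₁ (modifiedSelmerGroup W K ι ((p ^ k : ℕ) : ℤ) s'.1)) ∧
        Nat.card (signPart W K τ ((p ^ k : ℕ) : ℤ) e₁ (modifiedSelmerGroup W K ι ((p ^ k : ℕ) : ℤ) s'.1)) =
          p ^ k ∧
        signPart W K τ ((p ^ k : ℕ) : ℤ) e₂ (modifiedSelmerGroup W K ι ((p ^ k : ℕ) : ℤ) s'.1) = ⊥ := by
      rintro _ _ rfl rfl
      exact ⟨hcyc, hcard, hB⟩
    refine ⟨s'.1, D s', s'.2.1, fun q hq ↦ ⟨(s'.2.2 q hq).1, (s'.2.2 q hq).2⟩, ?_, hnt', hnd'⟩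
    -- the core vertex, sign by sign
    dsimp only [IsGlobalCoreVertex]
    cases hb : eb s'.1
    · obtain ⟨h1, h2, h3⟩ := hpack (-1) 1 (by simp [hb]) (by simp [hb])
      exact Or.inr ⟨h3, h1, h2⟩
    · obtain ⟨h1, h2, h3⟩ := hpack 1 (-1) (by simp [hb]) (by simp [hb])
      exact Or.inl ⟨h1, h2, h3⟩
  case hdisj =>
    -- [J] §4.2 at one completion: `H¹_f ∩ H¹_tr = 0` at a Kolyvagin `λ`
    intro ℓ hℓK hkℓ _ v hv
    exact Walk.globalTransverse_disjoint_kummer h𝒯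
      (P := fun ℓ ↦ Zhang2014.IsKolyvaginPrime (W.conductorNorm ℤ) W K p ℓ)
      (fun ℓ hℓ w hw ↦ Walk.disjoint_kummer_iInf_transverseSubgroup W K hK hD ι k hℓ w hw)
      (fun ℓ hℓ ↦ hℓ.1) ℓ hℓK v hv
  case hPT =>
    -- Lemma 5.2 (iii), primal form, per sign — Poitou–Tate + self-duality of `𝓕(s)`
    intro s₀ ℓ hℓK hksℓ hℓs _ _ w hw b
    have hkℓ : k ≤ Zhang2014.kolyvaginIndex W p ℓ := le_trans (Nat.le_add_right k s) hksℓ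
    obtain ⟨inv, hperf, hvan, -, hSC, hconj⟩ := hPT K (p ^ k)
    have h2 : 2 ≤ p ^ k := le_trans hp.two_le (Nat.le_self_pow (by omega) p)
    obtain ⟨e, hμ, hadd₁, hadd₂, hgal, halt, hnondeg, hτe⟩ := exists_weilDatum_liftAut W τ (p ^ k) h2
    have hs' : (if b then (1 : ℤ) else -1) = 1 ∨ (if b then (1 : ℤ) else -1) = -1 := by
      cases b <;> simp
    have hℓs' : ℓ ∉ s₀.1.primeFactors := fun h ↦ hℓs (Nat.dvd_of_mem_primeFactors h)
    exact Walk.natCard_map_localization_signPart_relaxedAt W τ p k e hμ hadd₁ hadd₂ hgal halt hnondeg hτe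
      hτ2 hp2 hk inv hperf hvan hSC (hconj τ) 𝒯 s₀.2.1.ne_zero (h𝒯σ' s₀)
      (Walk.globalTransverse_dualTransported_eq (ι := ι) h𝒯 s₀.2.1
        (fun 𝒯c h𝒯c ↦ RingClassTransverse.dualTransported_eq_of_localTransverseFamily W K hK hD ι p hp2 k hk
          s₀.1 s₀.2.1 (fun l hl ↦ (s₀.2.2 l hl).1)
          (fun l hl ↦ le_trans (Nat.le_add_right k s) (s₀.2.2 l hl).2) 𝒯c h𝒯c e hμ hadd₁ hadd₂
          hgal halt hnondeg)
        inv hperf)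
      hs' (fun ℓ' h1 h2' _ v' hv' hfix ↦
        GlobalDuality.relIndex_kummer_ker_conjActPlace_eq_pow W K hK (hPT K) hp2 hτ hτ2 hk ℓ' h1 h2' v' hv'
          hfix _ hs')
      ℓ hℓK hkℓ hℓs' w hw
  case hκt =>
    -- §3.1 item 7: the class `κ̃_{s₀}` of a `p^u`-th root of `P_{s₀}`, `u = m(s₀)`
    intro s₀ hcs₀ hs₀
    by_cases hlt : divOrd (D s₀) p < Zhang2014.levelIndex W p s₀.1
    · rw [if_pos hlt] at hs₀ ⊢
      have hne : divOrd (D s₀) p ≠ ⊤ := ne_top_of_lt hlt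
      obtain ⟨u, hu⟩ : ∃ u : ℕ, divOrd (D s₀) p = u := ⟨_, (ENat.coe_toNat hne).symm⟩
      rw [hu] at hs₀ hlt ⊢
      simp only [ENat.toNat_coe]
      have hdvd₀ : PDiv (D s₀) p u := pDiv_of_le_divOrd _ _ _ (le_of_eq hu.symm)
      have hndvd₀ : ¬ PDiv (D s₀) p (u + 1) := fun h ↦ by
        have h' := le_divOrd_of_pDiv (p := p) (D s₀) h
        rw [hu] at h'
        exact absurd (by exact_mod_cast h' : u + 1 ≤ u) (by omega)
      have huk : ((u + k : ℕ) : ℕ∞) ≤ Zhang2014.levelIndex W p s₀.1 := by push_cast; exact hs₀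
      have hkol : ∀ q ∈ s₀.1.primeFactors,
          Zhang2014.IsKolyvaginPrime (W.conductorNorm ℤ) W K p q ∧ k + u ≤ Zhang2014.kolyvaginIndex W p q :=
        fun q hq ↦ ⟨(s₀.2.2 q hq).1, by
          rw [Nat.add_comm]; exact Zhang2014.natCast_le_levelIndex_iff.mp huk q hq⟩
      obtain ⟨hAk, Q, hQ, hQP, hord, -⟩ := exists_tildeClass_of_exactDepth_of_surj (Dt := Dt) (β := β)
        hK hND hD hp hp2 hρ hk s₀.2.1 hkol (fun m' hm' ↦ D ⟨m', hadm s₀ m' hm'⟩) hdvd₀ hndvd₀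
      -- invariance of `[P_{s₀}]` mod `p^{k+u}` from the data at the divisors of `s₀`
      have hP : (D s₀).toGeomPoints (D s₀).derivedPoint ∈
          invPoints (absoluteGaloisGroup K) (D s₀).pointsSubgroup ((p ^ (k + u) : ℕ) : ℤ) :=
        KolyCert.toGeomPoints_derivedPoint_mem_invPoints_of_dvd_zhang hK ι Dt hp hND hD s₀.2.1 hkol
          (fun m' hm' ↦ D ⟨m', hadm s₀ m' hm'⟩) s₀.1 dvd_rfl
      -- PURE Selmer membership of the root class: Gross 6.2 (1) mod [GZ86 III (3.1)] at Kolyvagin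
      -- conductors (Kummer part, one level up) and Howard's transverseness (one level up)
      have hsel : (kolyvaginClass (W.baseChange K) ((p ^ k : ℕ) : ℤ)
            ((W.baseChange K).zsmul_geomPoints_surjective_of_charZero
              (by exact_mod_cast pow_ne_zero k hp.ne_zero)) hAk ((D s₀).toGeomPoints Q) hQ :
            galoisCohomology ((W.baseChange K).torsionGaloisModule ((p ^ k : ℕ) : ℤ)) 1) ∈
          (selmerF W ((p ^ k : ℕ) : ℤ) 𝒯 (placesDividing K s₀.1)).selmerGroup := by
        refine (SelmerVocabulary.mem_selmerGroup_selmerF_iff W _ 𝒯 s₀.2.1.ne_zero _).mpr ⟨?_, ?_⟩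
        · intro v hv
          refine Walk.localization_rootClass_mem_kummer W hK hp hp2 hρ s₀.2.1.ne_zero (D s₀) k u Q hAk hQ
            hQP hP v ?_
          exact localization_kolyvaginClass_mem_kummerSelmerStructure_of_GZ31_kolyvagin hK hD3 hD4 hH hp2
            hρ Dt β ι hcop' hGZ' s₀.2.1 hkol (D s₀) v hv
        · exact Walk.localization_rootClass_mem_globalTransverse W h𝒯 hK hp2 hρ s₀.2.1 hkol (D s₀) Q hAk hQ
            hQP hP (fun ℓ hℓ ↦ kolyvaginClass_mem_transverseKer W hK hD hp2 Dt β ι (k + u) s₀.2.1 hkol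
              (D s₀) hℓ)
      -- the sign: Gross Prop. 5.4 (1) for the root class, from Prop. 5.3 BY NAME
      have hsign := conjAct_kolyvaginClass_root_eq_sign_smul_zhang (Dt := Dt) (β := β) hK hp hp2 hρ hND hD
        hk s₀.2.1 hkol (fun m' hm' ↦ D ⟨m', hadm s₀ m' hm'⟩) hτ ε
        (fun m' hm' τm hτm ↦ h53 m' (hadm s₀ m' hm').1 (fun q hq ↦ ((hadm s₀ m' hm').2 q hq).1)
          (D ⟨m', hadm s₀ m' hm'⟩) τm hτm) Q hQP hAk hQ
      refine ⟨_, (mem_signPart_iff W K τ _ _ _ _).mpr ⟨hsel, by rw [hebε]; exact hsign⟩, hord, ?_⟩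
      -- ### the LINK `ι_* κ̃ = p^{s-u} · c_{k+s}(P_{s₀})`, read at a Kolyvagin place of index `≥ k+s`
      intro hus' ℓ hℓK hksℓ _ v hv hordx
      have hus : u ≤ s := by exact_mod_cast hus'
      -- admissibility and invariance at level `p^{k+s}` (from the data at the divisors of `s₀`)
      have hAks : IsAdmissible (absoluteGaloisGroup K) (D s₀).pointsSubgroup ((p ^ (k + s) : ℕ) : ℤ) :=
        X11b.RingClassNoTorsion.isAdmissible_pointsSubgroup _ hK s₀.2.1.ne_zero hp hp2 hρ (k + s)
      have hP2 : (D s₀).toGeomPoints (D s₀).derivedPoint ∈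
          invPoints (absoluteGaloisGroup K) (D s₀).pointsSubgroup ((p ^ (k + s) : ℕ) : ℤ) :=
        KolyCert.toGeomPoints_derivedPoint_mem_invPoints_of_dvd_zhang hK ι Dt hp hND hD s₀.2.1 s₀.2.2
          (fun m' hm' ↦ D ⟨m', hadm s₀ m' hm'⟩) s₀.1 dvd_rfl
      -- the LEVEL LINK (`Rank1ResidualJetTildeClassLevelLink.lean`) at `v ∣ ℓ`, `M(ℓ) ≥ k + s`
      exact addOrderOf_localization_kolyvaginClass_of_rootClass (D s₀) hp hk hus hAk hAks hQ hQP hP2 v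
        (fun g T ↦ Walk.resGal_adicCompletion_smul_torsion_eq_self W hK hℓK hksℓ v hv g T) hordx
    · -- degenerate case `M(s₀) = ∞`: then `s₀ = c = 1`, where the given datum has finite depth
      exfalso
      rw [if_neg hlt, top_add, top_le_iff] at hs₀
      have h1 : s₀.1 = 1 := by
        by_contra hne1
        have hlt1 : 1 < s₀.1 :=
          Nat.lt_of_le_of_ne (Nat.one_le_iff_ne_zero.mpr s₀.2.1.ne_zero) (Ne.symm hne1)
        obtain ⟨q, hq⟩ := Nat.nonempty_primeFactors.mpr hlt1
        have hle : Zhang2014.levelIndex W p s₀.1 ≤ (Zhang2014.kolyvaginIndex W p q : ℕ∞) :=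
          Finset.inf_le hq
        rw [hs₀, top_le_iff] at hle
        exact ENat.coe_ne_top _ hle
      have hc1 : c = 1 := Nat.dvd_one.mp (h1 ▸ hcs₀)
      have hs₀c : s₀ = ⟨c, hc⟩ := Subtype.ext (h1.trans hc1.symm)
      refine hlt ?_
      rw [hs₀, hs₀c, hdiv]
      exact ENat.coe_lt_top s

/-- **K5 VERBATIM with EVERY input a named Literature statement**: `JET.JetchevCoreVertexExistence`
follows from Poitou–Tate duality for Selmer structures (`hPT`), F1 = [GZ86 III (3.1)] as Gross 1991 §6
uses it (`hF1`, fed to the receptacle schema by `JET.forall_hGZ_of_Gross1991`) and (γ) = Gross 1991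
Prop. 3.7 (2) image-free (`h372`, giving [McC] Prop. 4.4 by `JET.prop44_of_frobeniusCongruence`).
[cite: Jetchev2008, Prop. 5.3 (p. 823)] [cite: McCallumLMS1991, §4 Prop. 4.4] [cite: GrossLMS1991, Prop. 3.7 (2), §6]
[cite: GrossZagier1986, III (3.1)] -/
theorem jetchevCoreVertexExistence_of_literature
    (hPT : ∀ (K : Type) [Field K] [NumberField K], poitouTate_selmerStructure_duality_conj K)
    (hF1 : Gross1991_heegnerPoint_sub_ratTorsion_mem_E0)
    (h372 : GrossLMS1991.prop37_2_frobeniusCongruence) :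
    JetchevCoreVertexExistence :=
  jetchevCoreVertexExistence_of_namedPrint (prop44_of_frobeniusCongruence h372) hPT
    (forall_hGZ_of_Gross1991 hF1)

end Summit.BirchSwinnertonDyer.Rank1Residual.JET

end
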